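import Summits.RiemannHypothesis.RiemannHypothesis.Theorems.GroundBartaPolarPerronFrobeniusSourceFubini
import HarnessLib

/-!
# RiemannHypothesis / GroundBarta — crux `PolarPerronFrobenius` (stmt-RiemannHypothesis-18390):
# the source criterion, part S3: the SHARP SIGN-DEFECT IDENTITY and the SOURCE CRITERION

Helper file (`--supports stmt-RiemannHypothesis-18390`), RH-free, Mathlib + proved tree files only,
no definitions, no named facts.  Notation: `f` real smooth with `tsupport f ⊆ [-a, a]`, `a > 0`,
`p = f⁺`, `n = f⁻`, `F = f`, `A = |f|`, `W_η = ψ_η ∘ f = √(f² + η²) − η` (smooth, `≥ 0`),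
`w = weilArchDensity`, `Λ(n)n^{-1/2}` the prime rates of the window (`weilPrimeIndex a`), and the
**SOURCE of `f⁺` at `y`**

  `S_f(y) = ∫ f⁺(x) w(|x−y|) dx + Σ_{log n<2a} Λ(n)n^{-1/2} (f⁺(y+log n) + f⁺(y−log n))
            − 2∫ f⁺(x) cosh((x−y)/2) dx`

(Markov attraction of the positive part — archimedean and prime jumps — minus its polar repulsion).

* `swu_weilPoleForm_abs_sub_eq`: `P(|f|) − P(f) = 8∫ f⁻(y) ∫ f⁺(x)cosh((x−y)/2) dx dy` (any real `f`);
* `swu_tendsto_re_weilQuadratic_psi`: **THE SIGN-DEFECT IDENTITY**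
  `Re Q(W_η) → Re Q(f) − 4∫ f⁻(y) S_f(y) dy` as `η → 0⁺`
  (Markov decomposition + exact energy bookkeeping + the untruncated Fubini of parts S1–S2; this is
  the sharp form of the sign-defect criterion `…SignDefectCriterion.lean`, whose defect
  `(8cosh a − 4w(2a))∫f⁺∫f⁻` is the crude bound `S_f ≥ (w(2a) − 2cosh a)∫f⁺`);
* `swu_exists_nonneg_test_lt_of_source`, `swu_cone_of_source`: **THE SOURCE CRITERION** — if
  `S_f(y) ≥ 0` at every `y` with `f(y) < 0`, then for every `δ > 0` a smooth NON-NEGATIVE window test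
  (`W_η`, even if `f` is even) comes within `δ` of the Rayleigh quotient of `f`.  This is the TEST-LEVEL
  form of the harmonic-majorant card's `edgeLayerCriterion` (`Cruxes/PolarPerronFrobenius/Ideas/
  harmonic-majorant-edge-source.md`): no Euler–Lagrange equation, no form domain, and the
  archimedean kernel is NOT truncated, so the capacity term `∫_{bulk} f⁺ w(|x−y|) ≈ ½f⁺·log(1/ζ)` of a
  thin negative layer is fully available in `S_f`.  The pointwise criteria are special cases:
  parity-free (`w ≥ 2cosh(·/2)` on `(0, 2a]`, `a ≤ 0.1406`) and even-sector (symmetrised kernel,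
  `a ≤ 0.277`, parts E1–E3).

Prover B, speedrun unit `sr-gb-rung-b` (seat 2).
-/

set_option linter.dupNamespace false

noncomputable section

open Set MeasureTheory Filter Complex
open scoped Real Topology

namespace Summit.RiemannHypothesis.RiemannHypothesis.Theorems.PolarPerronFrobenius

open Literature.NumberTheory.LFunctions
open scoped ArithmeticFunction.vonMangoldt

section Identity

variable {f : ℝ → ℝ} {a : ℝ}

/-- **Polar loss in source form**: `P(|f|) − P(f) = 8∫ f⁻(y) (∫ f⁺(x) cosh((x−y)/2) dx) dy`
(`= 8(C⁺C⁻ − S⁺S⁻)` and `cosh(x/2)cosh(y/2) − sinh(x/2)sinh(y/2) = cosh((x−y)/2)`). [folklore] -/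
theorem swu_weilPoleForm_abs_sub_eq (hfc : Continuous f) (hfs : HasCompactSupport f) :
    weilPoleForm (fun t ↦ ((|f t| : ℝ) : ℂ)) - weilPoleForm (fun t ↦ ((f t : ℝ) : ℂ)) =
      8 * ∫ y, max (-f y) 0 * ∫ x, max (f x) 0 * Real.cosh ((x - y) / 2) := by
  have hcosh : Continuous fun t : ℝ ↦ Real.cosh (t / 2) :=
    Real.continuous_cosh.comp (continuous_id.div_const 2)
  have hsinh : Continuous fun t : ℝ ↦ Real.sinh (t / 2) :=
    Real.continuous_sinh.comp (continuous_id.div_const 2)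
  set Cp : ℝ := ∫ t, max (f t) 0 * Real.cosh (t / 2) with hCp
  set Cm : ℝ := ∫ t, max (-f t) 0 * Real.cosh (t / 2) with hCm
  set Sp : ℝ := ∫ t, max (f t) 0 * Real.sinh (t / 2) with hSp
  set Sm : ℝ := ∫ t, max (-f t) 0 * Real.sinh (t / 2) with hSm
  have e1 : ∫ t, ((|f t| : ℝ) : ℂ) * (Real.cosh (t / 2) : ℂ) = ((Cp + Cm : ℝ) : ℂ) :=
    sw_integral_abs_mul_eq hfc hfs hcosh
  have e2 : ∫ t, ((|f t| : ℝ) : ℂ) * (Real.sinh (t / 2) : ℂ) = ((Sp + Sm : ℝ) : ℂ) :=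
    sw_integral_abs_mul_eq hfc hfs hsinh
  have e3 : ∫ t, ((f t : ℝ) : ℂ) * (Real.cosh (t / 2) : ℂ) = ((Cp - Cm : ℝ) : ℂ) :=
    sw_integral_self_mul_eq hfc hfs hcosh
  have e4 : ∫ t, ((f t : ℝ) : ℂ) * (Real.sinh (t / 2) : ℂ) = ((Sp - Sm : ℝ) : ℂ) :=
    sw_integral_self_mul_eq hfc hfs hsinh
  have hP : weilPoleForm (fun t ↦ ((|f t| : ℝ) : ℂ)) - weilPoleForm (fun t ↦ ((f t : ℝ) : ℂ)) =
      8 * (Cp * Cm - Sp * Sm) := by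
    unfold weilPoleForm
    rw [e1, e2, e3, e4]
    simp only [Complex.norm_real, Real.norm_eq_abs, sq_abs]
    ring
  -- the inner integral: `∫ f⁺(x)cosh((x-y)/2) dx = cosh(y/2) C⁺ − sinh(y/2) S⁺`
  have ipc := sw_integrable_posPart_mul hfc hfs hcosh
  have ips := sw_integrable_posPart_mul hfc hfs hsinh
  have key : ∀ y, ∫ x, max (f x) 0 * Real.cosh ((x - y) / 2) =
      Real.cosh (y / 2) * Cp - Real.sinh (y / 2) * Sp := by
    intro y
    have hpt : ∀ x, max (f x) 0 * Real.cosh ((x - y) / 2) =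
        Real.cosh (y / 2) * (max (f x) 0 * Real.cosh (x / 2)) -
          Real.sinh (y / 2) * (max (f x) 0 * Real.sinh (x / 2)) := by
      intro x
      rw [show (x - y) / 2 = x / 2 - y / 2 by ring, Real.cosh_sub]
      ring
    simp_rw [hpt]
    rw [integral_sub (ipc.const_mul _) (ips.const_mul _), integral_const_mul, integral_const_mul]
  simp_rw [key]
  have inc := sw_integrable_negPart_mul hfc hfs hcosh
  have ins := sw_integrable_negPart_mul hfc hfs hsinh
  have hsplit : ∫ y, max (-f y) 0 * (Real.cosh (y / 2) * Cp - Real.sinh (y / 2) * Sp) = Cp * Cm - Sp * Sm := by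
    have hpt : ∀ y, max (-f y) 0 * (Real.cosh (y / 2) * Cp - Real.sinh (y / 2) * Sp) =
        Cp * (max (-f y) 0 * Real.cosh (y / 2)) - Sp * (max (-f y) 0 * Real.sinh (y / 2)) := by
      intro y; ring
    simp_rw [hpt]
    rw [integral_sub (inc.const_mul _) (ins.const_mul _), integral_const_mul, integral_const_mul]
  rw [hP, hsplit]

/-- **THE SIGN-DEFECT IDENTITY.**  For a real smooth `f` with `tsupport f ⊆ [-a, a]`, `a > 0`, along
the smooth non-negative approximants `W_η = √(f² + η²) − η` of `|f|`:

`Re Q(W_η) ⟶ Re Q(f) − 4 ∫ f⁻(y) S_f(y) dy`  (`η → 0⁺`),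

`S_f(y) = ∫ f⁺(x)w(|x−y|)dx + Σ_{log n<2a} Λ(n)n^{-1/2}(f⁺(y+log n) + f⁺(y−log n)) − 2∫ f⁺(x)cosh((x−y)/2)dx`.
[folklore] -/
theorem swu_tendsto_re_weilQuadratic_psi (hf : ContDiff ℝ (⊤ : ℕ∞) f) (hfs : HasCompactSupport f)
    (ha : 0 < a) (hsupp : tsupport f ⊆ Icc (-a) a) :
    Tendsto (fun η : ℝ ↦ (weilQuadratic (fun t ↦ ((Real.sqrt (f t ^ 2 + η ^ 2) - η : ℝ) : ℂ))).re)
      (𝓝[>] 0)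
      (𝓝 ((weilQuadratic (fun t ↦ ((f t : ℝ) : ℂ))).re - 4 * ∫ y, max (-f y) 0 *
        ((∫ x, max (f x) 0 * weilArchDensity |x - y|) +
          (∑ n ∈ weilPrimeIndex a, (Λ n : ℝ) / Real.sqrt n *
            (max (f (y + Real.log n)) 0 + max (f (y - Real.log n)) 0)) -
          2 * ∫ x, max (f x) 0 * Real.cosh ((x - y) / 2)))) := by
  have hfc : Continuous f := hf.continuous
  have hsupp' : Function.support f ⊆ Icc (-a) a := (subset_tsupport f).trans hsupp
  have hp : Continuous fun x ↦ max (f x) 0 := hfc.max continuous_const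
  have hn : Continuous fun x ↦ max (-f x) 0 := hfc.neg.max continuous_const
  have hns := swe_hasCompactSupport_negPart hfs
  have hps := swe_hasCompactSupport_posPart hfs
  have hF : IsWeilTest fun t ↦ ((f t : ℝ) : ℂ) := sw_isWeilTest_ofReal_comp hf hfs
  have hFs : tsupport (fun t ↦ ((f t : ℝ) : ℂ)) ⊆ Icc (-a) a := (sw_tsupport_ofReal_comp f).symm ▸ hsupp
  -- notation
  set F : ℝ → ℂ := fun t ↦ ((f t : ℝ) : ℂ) with hFdef
  set A : ℝ → ℂ := fun t ↦ ((|f t| : ℝ) : ℂ) with hAdef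
  set QF : ℝ := (weilQuadratic F).re with hQF
  set PF : ℝ := weilPoleForm F with hPF
  set PA : ℝ := weilPoleForm A with hPA
  set EF : ℝ := weilDirichletEnergy a F with hEF
  set M : ℝ := weilMarkovConstant a with hM
  set NF : ℝ := ∫ t, ‖F t‖ ^ 2 with hNF
  set Nw : ℝ → ℝ := fun η ↦ ∫ t, ‖((Real.sqrt (f t ^ 2 + η ^ 2) - η : ℝ) : ℂ)‖ ^ 2 with hNw
  set Pw : ℝ → ℝ := fun η ↦ weilPoleForm (fun t ↦ ((Real.sqrt (f t ^ 2 + η ^ 2) - η : ℝ) : ℂ))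
    with hPw
  set pg : ℝ → ℝ := fun η ↦ ∑ n ∈ weilPrimeIndex a, (Λ n : ℝ) / Real.sqrt n *
      (weilIncrement F (Real.log n) -
        weilIncrement (fun x ↦ ((Real.sqrt (f x ^ 2 + η ^ 2) - η : ℝ) : ℂ)) (Real.log n)) with hpg
  set ag : ℝ → ℝ := fun η ↦ ∫ t in Ioi (0 : ℝ), weilArchDensity t *
      (weilIncrement F t - weilIncrement (fun x ↦ ((Real.sqrt (f x ^ 2 + η ^ 2) - η : ℝ) : ℂ)) t)
    with hag
  set pg0 : ℝ := ∑ n ∈ weilPrimeIndex a, (Λ n : ℝ) / Real.sqrt n *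
      (weilIncrement F (Real.log n) - weilIncrement A (Real.log n)) with hpg0
  set ag0 : ℝ := ∫ t in Ioi (0 : ℝ), weilArchDensity t * (weilIncrement F t - weilIncrement A t)
    with hag0
  -- (1) eventual formula for `Re Q(W_η)`
  have hform : ∀ᶠ η : ℝ in 𝓝[>] 0,
      (weilQuadratic (fun t ↦ ((Real.sqrt (f t ^ 2 + η ^ 2) - η : ℝ) : ℂ))).re =
        Pw η + (EF - pg η - ag η) - M * Nw η := by
    filter_upwards [self_mem_nhdsWithin] with η (hη : 0 < η)
    have hW : IsWeilTest fun t ↦ ((Real.sqrt (f t ^ 2 + η ^ 2) - η : ℝ) : ℂ) :=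
      sw_isWeilTest_psi_comp hf hfs hη
    have hWs : tsupport (fun t ↦ ((Real.sqrt (f t ^ 2 + η ^ 2) - η : ℝ) : ℂ)) ⊆ Icc (-a) a :=
      (sw_tsupport_psi_comp_subset hη.le).trans hsupp
    have h1 := weilQuadratic_re_eq_weilPoleForm_add_weilDirichletEnergy_sub hW hWs
    have h3 := swu_weilDirichletEnergy_sub_eq hf hfs a hη
    simp only [hPw, hEF, hpg, hag, hM, hNw]
    rw [h1]
    linarith
  -- (2) the limit of the formula
  have hN : Tendsto Nw (𝓝[>] 0) (𝓝 NF) := sw_tendsto_integral_norm_sq_psi hfc hfs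
  have hP : Tendsto Pw (𝓝[>] 0) (𝓝 PA) := sw_tendsto_weilPoleForm_psi hfc hsupp'
  have hpgl : Tendsto pg (𝓝[>] 0) (𝓝 pg0) := swu_tendsto_primeGain hf hfs a
  have hagl : Tendsto ag (𝓝[>] 0) (𝓝 ag0) := swu_tendsto_archGain hf hfs
  have hlim : Tendsto (fun η ↦ Pw η + (EF - pg η - ag η) - M * Nw η) (𝓝[>] 0)
      (𝓝 (PA + (EF - pg0 - ag0) - M * NF)) :=
    (hP.add ((tendsto_const_nhds.sub hpgl).sub hagl)).sub (hN.const_mul M)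
  -- (3) identify the limit
  have h2 : QF = PF + EF - M * NF := weilQuadratic_re_eq_weilPoleForm_add_weilDirichletEnergy_sub hF hFs
  -- prime gain in source form
  have hpg0' : pg0 = 4 * ∫ y, max (-f y) 0 * ∑ n ∈ weilPrimeIndex a, (Λ n : ℝ) / Real.sqrt n *
      (max (f (y + Real.log n)) 0 + max (f (y - Real.log n)) 0) := by
    have hterm : ∀ n ∈ weilPrimeIndex a, (Λ n : ℝ) / Real.sqrt n *
        (weilIncrement F (Real.log n) - weilIncrement A (Real.log n)) =
        ∫ y, 4 * ((Λ n : ℝ) / Real.sqrt n *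
          (max (-f y) 0 * (max (f (y + Real.log n)) 0 + max (f (y - Real.log n)) 0))) := by
      intro n _
      rw [swe_weilIncrement_sub_abs hfc hfs (Real.log n), ← integral_const_mul, ← integral_const_mul]
      refine integral_congr_ae (Eventually.of_forall fun y ↦ ?_); simp only; ring
    rw [hpg0, Finset.sum_congr rfl hterm, ← integral_finsetSum _ (fun n _ ↦ ?_), ← integral_const_mul]
    · refine integral_congr_ae (Eventually.of_forall fun y ↦ ?_)
      simp only [Finset.mul_sum]
      exact Finset.sum_congr rfl fun n _ ↦ by ring
    · refine (Continuous.integrable_of_hasCompactSupport ?_ ?_)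
      · exact continuous_const.mul (continuous_const.mul (hn.mul
          ((hp.comp (continuous_id.add continuous_const)).add
            (hp.comp (continuous_id.sub continuous_const)))))
      · exact ((hns.mul_right).mul_left).mul_left
  -- archimedean gain in source form
  set G : ℝ → ℝ := fun t ↦ weilIncrement F t - weilIncrement A t with hGdef
  have hG : ∀ t, G (-t) = G t := fun t ↦ by simp only [hGdef, weilIncrement_neg]
  have hag0' : ag0 = 4 * ∫ y, max (-f y) 0 * ∫ x, max (f x) 0 * weilArchDensity |x - y| := by
    have e1 := swu_two_mul_setIntegral_eq hG
    have e2 : ∫ t, weilArchDensity |t| * G t =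
        ∫ t, weilArchDensity |t| * (4 * ∫ x, max (-f x) 0 * (max (f (x + t)) 0 + max (f (x - t)) 0)) :=
      integral_congr_ae (Eventually.of_forall fun t ↦ by
        simp only [hGdef, hFdef, hAdef]; rw [swe_weilIncrement_sub_abs hfc hfs t])
    have e3 := swu_gain_fubini hf hfs ha hsupp'
    have e4 : ∫ x, max (-f x) 0 * ∫ t, weilArchDensity |t| * (max (f (x + t)) 0 + max (f (x - t)) 0) =
        ∫ x, max (-f x) 0 * (2 * ∫ y, max (f y) 0 * weilArchDensity |y - x|) := by
      refine integral_congr_ae (Eventually.of_forall fun x ↦ ?_)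
      simp only
      by_cases hx : f x < 0
      · rw [swu_inner_eq hf hfs ha hsupp' hx]
        congr 2
        refine integral_congr_ae (Eventually.of_forall fun y ↦ ?_)
        simp only; rw [abs_sub_comm]; ring
      · rw [max_eq_right (by linarith), zero_mul, zero_mul]
    have e5 : ∫ x, max (-f x) 0 * (2 * ∫ y, max (f y) 0 * weilArchDensity |y - x|) =
        2 * ∫ y, max (-f y) 0 * ∫ x, max (f x) 0 * weilArchDensity |x - y| := by
      rw [← integral_const_mul]
      refine integral_congr_ae (Eventually.of_forall fun x ↦ ?_); simp only; ring
    have e6 : ag0 = ∫ t in Ioi (0 : ℝ), weilArchDensity t * G t := by simp only [hag0, hGdef]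
    rw [e6]
    linarith [e1, e2, e3, e4, e5]
  -- polar loss in source form
  have hpol := swu_weilPoleForm_abs_sub_eq hfc hfs
  -- integrability of the three `y`-integrands (for linearity)
  have iM := swu_integrable_marginal hf hfs ha hsupp'
  have i1 : Integrable fun y ↦ max (-f y) 0 * ∫ x, max (f x) 0 * weilArchDensity |x - y| := by
    have h := iM.const_mul (1 / 2)
    refine h.congr (Eventually.of_forall fun y ↦ ?_)
    simp only
    by_cases hy : f y < 0
    · rw [swu_inner_eq hf hfs ha hsupp' hy]
      have : ∫ x, weilArchDensity |y - x| * max (f x) 0 = ∫ x, max (f x) 0 * weilArchDensity |x - y| :=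
        integral_congr_ae (Eventually.of_forall fun x ↦ by simp only; rw [abs_sub_comm]; ring)
      rw [this]; ring
    · rw [max_eq_right (by linarith), zero_mul, zero_mul, mul_zero]
  have i2 : Integrable fun y ↦ max (-f y) 0 * ∑ n ∈ weilPrimeIndex a, (Λ n : ℝ) / Real.sqrt n *
      (max (f (y + Real.log n)) 0 + max (f (y - Real.log n)) 0) := by
    refine Continuous.integrable_of_hasCompactSupport (hn.mul (continuous_finsetSum _ fun n _ ↦
      continuous_const.mul ((hp.comp (continuous_id.add continuous_const)).add
        (hp.comp (continuous_id.sub continuous_const))))) hns.mul_right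
  have hcosh : Continuous fun t : ℝ ↦ Real.cosh (t / 2) :=
    Real.continuous_cosh.comp (continuous_id.div_const 2)
  have hsinh : Continuous fun t : ℝ ↦ Real.sinh (t / 2) :=
    Real.continuous_sinh.comp (continuous_id.div_const 2)
  have i3 : Integrable fun y ↦ max (-f y) 0 * ∫ x, max (f x) 0 * Real.cosh ((x - y) / 2) := by
    have ipc := sw_integrable_posPart_mul hfc hfs hcosh
    have ips := sw_integrable_posPart_mul hfc hfs hsinh
    have key : ∀ y, ∫ x, max (f x) 0 * Real.cosh ((x - y) / 2) =
        Real.cosh (y / 2) * (∫ x, max (f x) 0 * Real.cosh (x / 2)) -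
          Real.sinh (y / 2) * ∫ x, max (f x) 0 * Real.sinh (x / 2) := by
      intro y
      have hpt : ∀ x, max (f x) 0 * Real.cosh ((x - y) / 2) =
          Real.cosh (y / 2) * (max (f x) 0 * Real.cosh (x / 2)) -
            Real.sinh (y / 2) * (max (f x) 0 * Real.sinh (x / 2)) := by
        intro x; rw [show (x - y) / 2 = x / 2 - y / 2 by ring, Real.cosh_sub]; ring
      simp_rw [hpt]
      rw [integral_sub (ipc.const_mul _) (ips.const_mul _), integral_const_mul, integral_const_mul]
    simp_rw [key]
    have inc := sw_integrable_negPart_mul hfc hfs hcosh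
    have ins := sw_integrable_negPart_mul hfc hfs hsinh
    have i3a : Integrable (fun y ↦ max (-f y) 0 * Real.cosh (y / 2) *
        ∫ x, max (f x) 0 * Real.cosh (x / 2)) := inc.mul_const _
    have i3b : Integrable (fun y ↦ max (-f y) 0 * Real.sinh (y / 2) *
        ∫ x, max (f x) 0 * Real.sinh (x / 2)) := ins.mul_const _
    exact (i3a.sub i3b).congr (Eventually.of_forall fun y ↦ by simp only [Pi.sub_apply]; ring)
  have hsum : ∫ y, max (-f y) 0 *
      ((∫ x, max (f x) 0 * weilArchDensity |x - y|) +
        (∑ n ∈ weilPrimeIndex a, (Λ n : ℝ) / Real.sqrt n *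
          (max (f (y + Real.log n)) 0 + max (f (y - Real.log n)) 0)) -
        2 * ∫ x, max (f x) 0 * Real.cosh ((x - y) / 2)) =
      (∫ y, max (-f y) 0 * ∫ x, max (f x) 0 * weilArchDensity |x - y|) +
        (∫ y, max (-f y) 0 * ∑ n ∈ weilPrimeIndex a, (Λ n : ℝ) / Real.sqrt n *
          (max (f (y + Real.log n)) 0 + max (f (y - Real.log n)) 0)) -
        2 * ∫ y, max (-f y) 0 * ∫ x, max (f x) 0 * Real.cosh ((x - y) / 2) := by
    have i12 : Integrable (fun y ↦ max (-f y) 0 * (∫ x, max (f x) 0 * weilArchDensity |x - y|) +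
        max (-f y) 0 * ∑ n ∈ weilPrimeIndex a, (Λ n : ℝ) / Real.sqrt n *
          (max (f (y + Real.log n)) 0 + max (f (y - Real.log n)) 0)) := i1.add i2
    have i3' : Integrable (fun y ↦ 2 * (max (-f y) 0 * ∫ x, max (f x) 0 * Real.cosh ((x - y) / 2))) :=
      i3.const_mul 2
    have e : (fun y ↦ max (-f y) 0 *
        ((∫ x, max (f x) 0 * weilArchDensity |x - y|) +
          (∑ n ∈ weilPrimeIndex a, (Λ n : ℝ) / Real.sqrt n *
            (max (f (y + Real.log n)) 0 + max (f (y - Real.log n)) 0)) -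
          2 * ∫ x, max (f x) 0 * Real.cosh ((x - y) / 2))) =
        fun y ↦ (max (-f y) 0 * (∫ x, max (f x) 0 * weilArchDensity |x - y|) +
          max (-f y) 0 * ∑ n ∈ weilPrimeIndex a, (Λ n : ℝ) / Real.sqrt n *
            (max (f (y + Real.log n)) 0 + max (f (y - Real.log n)) 0)) -
          2 * (max (-f y) 0 * ∫ x, max (f x) 0 * Real.cosh ((x - y) / 2)) := by
      funext y; ring
    rw [e, integral_sub i12 i3', integral_add i1 i2, integral_const_mul]
  have hval : PA + (EF - pg0 - ag0) - M * NF = QF - 4 * ∫ y, max (-f y) 0 *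
      ((∫ x, max (f x) 0 * weilArchDensity |x - y|) +
        (∑ n ∈ weilPrimeIndex a, (Λ n : ℝ) / Real.sqrt n *
          (max (f (y + Real.log n)) 0 + max (f (y - Real.log n)) 0)) -
        2 * ∫ x, max (f x) 0 * Real.cosh ((x - y) / 2)) := by
    rw [hsum, h2, hpg0', hag0']
    linarith [hpol]
  rw [← hval]
  exact hlim.congr' (hform.mono fun η h ↦ h.symm)

end Identity

/-! ## The source criterion -/

section Criterion

variable {f : ℝ → ℝ} {a : ℝ}

/-- **THE SOURCE CRITERION (test level, RH-free).**  Let `f` be real smooth with `tsupport f ⊆ [-a, a]`,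
`a > 0`, `‖f‖₂ = 1`, and suppose the source of `f⁺` is non-negative on the negative set of `f`:
`S_f(y) ≥ 0` whenever `f(y) < 0`.  Then for every `δ > 0` some smooth non-negative approximant
`W_η = ψ_η ∘ f` (`η > 0`) has `‖W_η‖₂ > 0` and `Re Q(W_η) < ‖W_η‖₂² (Re Q(f) + δ)`. [folklore] -/
theorem swu_exists_nonneg_test_lt_of_source (hf : ContDiff ℝ (⊤ : ℕ∞) f) (hfs : HasCompactSupport f)
    (ha : 0 < a) (hsupp : tsupport f ⊆ Icc (-a) a) (hnorm : ∫ t, ‖((f t : ℝ) : ℂ)‖ ^ 2 = 1)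
    (hsrc : ∀ y, f y < 0 → 0 ≤ (∫ x, max (f x) 0 * weilArchDensity |x - y|) +
      (∑ n ∈ weilPrimeIndex a, (Λ n : ℝ) / Real.sqrt n *
        (max (f (y + Real.log n)) 0 + max (f (y - Real.log n)) 0)) -
      2 * ∫ x, max (f x) 0 * Real.cosh ((x - y) / 2))
    {δ : ℝ} (hδ : 0 < δ) :
    ∃ η : ℝ, 0 < η ∧ 0 < ∫ t, ‖((Real.sqrt (f t ^ 2 + η ^ 2) - η : ℝ) : ℂ)‖ ^ 2 ∧
      (weilQuadratic (fun t ↦ ((Real.sqrt (f t ^ 2 + η ^ 2) - η : ℝ) : ℂ))).re <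
        (∫ t, ‖((Real.sqrt (f t ^ 2 + η ^ 2) - η : ℝ) : ℂ)‖ ^ 2) *
          ((weilQuadratic (fun t ↦ ((f t : ℝ) : ℂ))).re + δ) := by
  have hfc : Continuous f := hf.continuous
  set QF : ℝ := (weilQuadratic (fun t ↦ ((f t : ℝ) : ℂ))).re with hQF
  set I : ℝ := ∫ y, max (-f y) 0 *
      ((∫ x, max (f x) 0 * weilArchDensity |x - y|) +
        (∑ n ∈ weilPrimeIndex a, (Λ n : ℝ) / Real.sqrt n *
          (max (f (y + Real.log n)) 0 + max (f (y - Real.log n)) 0)) -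
        2 * ∫ x, max (f x) 0 * Real.cosh ((x - y) / 2)) with hI
  set Nw : ℝ → ℝ := fun η ↦ ∫ t, ‖((Real.sqrt (f t ^ 2 + η ^ 2) - η : ℝ) : ℂ)‖ ^ 2 with hNw
  have hI0 : 0 ≤ I := by
    refine integral_nonneg fun y ↦ ?_
    by_cases hy : f y < 0
    · exact mul_nonneg (le_max_right _ _) (hsrc y hy)
    · have h0 : max (-f y) 0 = 0 := max_eq_right (by linarith)
      simp [h0]
  have hQ := swu_tendsto_re_weilQuadratic_psi hf hfs ha hsupp
  have hN : Tendsto Nw (𝓝[>] 0) (𝓝 1) := by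
    have h := sw_tendsto_integral_norm_sq_psi hfc hfs
    rwa [hnorm] at h
  have hU : Tendsto (fun η ↦ (weilQuadratic (fun t ↦ ((Real.sqrt (f t ^ 2 + η ^ 2) - η : ℝ) : ℂ))).re -
      Nw η * (QF + δ)) (𝓝[>] 0) (𝓝 ((QF - 4 * I) - 1 * (QF + δ))) :=
    hQ.sub (hN.mul tendsto_const_nhds)
  have hneg : (QF - 4 * I) - 1 * (QF + δ) < 0 := by linarith
  have hev1 := (tendsto_order.1 hU).2 _ hneg
  have hev2 : ∀ᶠ η in 𝓝[>] (0 : ℝ), 1 / 2 < Nw η := (tendsto_order.1 hN).1 _ (by norm_num)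
  have hev3 : ∀ᶠ η in 𝓝[>] (0 : ℝ), 0 < η := self_mem_nhdsWithin
  obtain ⟨η, hη1, hη2, hη3⟩ := (hev1.and (hev2.and hev3)).exists
  refine ⟨η, hη3, by simp only [hNw] at hη2; linarith, ?_⟩
  simp only [hNw] at hη1 hη2 ⊢
  linarith

/-- **The source criterion, cone form.**  Under the hypotheses of
`swu_exists_nonneg_test_lt_of_source` there is, for every `δ > 0`, an `L²`-NORMALISED smooth window
test `w` on `[-a, a]`, pointwise real and `≥ 0`, with `Re Q(w) ≤ Re Q(f) + δ`; `w` is even if `f` is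
even (it is a multiple of `ψ_η ∘ f`). [folklore] -/
theorem swu_cone_of_source (hf : ContDiff ℝ (⊤ : ℕ∞) f) (hfs : HasCompactSupport f)
    (ha : 0 < a) (hsupp : tsupport f ⊆ Icc (-a) a) (hnorm : ∫ t, ‖((f t : ℝ) : ℂ)‖ ^ 2 = 1)
    (hsrc : ∀ y, f y < 0 → 0 ≤ (∫ x, max (f x) 0 * weilArchDensity |x - y|) +
      (∑ n ∈ weilPrimeIndex a, (Λ n : ℝ) / Real.sqrt n *
        (max (f (y + Real.log n)) 0 + max (f (y - Real.log n)) 0)) -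
      2 * ∫ x, max (f x) 0 * Real.cosh ((x - y) / 2))
    {δ : ℝ} (hδ : 0 < δ) :
    ∃ w : ℝ → ℂ, IsWeilTest w ∧ tsupport w ⊆ Icc (-a) a ∧ (∀ t, (w t).im = 0 ∧ 0 ≤ (w t).re) ∧
      ∫ t, ‖w t‖ ^ 2 = 1 ∧
      (weilQuadratic w).re ≤ (weilQuadratic fun t ↦ ((f t : ℝ) : ℂ)).re + δ ∧
      ((∀ t, f (-t) = f t) → ∀ t, w (-t) = w t) := by
  obtain ⟨η, hη, hNpos, hlt⟩ := swu_exists_nonneg_test_lt_of_source hf hfs ha hsupp hnorm hsrc hδ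
  set W : ℝ → ℂ := fun t ↦ ((Real.sqrt (f t ^ 2 + η ^ 2) - η : ℝ) : ℂ) with hWdef
  set N : ℝ := ∫ t, ‖W t‖ ^ 2 with hN
  have hW : IsWeilTest W := sw_isWeilTest_psi_comp hf hfs hη
  have hWs : tsupport W ⊆ Icc (-a) a := (sw_tsupport_psi_comp_subset hη.le).trans hsupp
  set c : ℝ := (Real.sqrt N)⁻¹ with hc
  have hcpos : 0 < c := inv_pos.2 (Real.sqrt_pos.2 hNpos)
  have hcc : c * c = 1 / N := by
    rw [hc, ← mul_inv, Real.mul_self_sqrt hNpos.le, one_div]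
  refine ⟨fun t ↦ (c : ℂ) * W t, hW.const_mul c, tsupport_mul_subset_right.trans hWs,
    fun t ↦ ?_, ?_, ?_, fun hfe t ↦ ?_⟩
  · simp only [hWdef, ← Complex.ofReal_mul, Complex.ofReal_im, Complex.ofReal_re]
    exact ⟨trivial, mul_nonneg hcpos.le (sw_psi_nonneg hη.le _)⟩
  · simp only [norm_mul, mul_pow, Complex.norm_real, Real.norm_of_nonneg hcpos.le]
    rw [integral_const_mul, ← hN, hc, inv_pow, Real.sq_sqrt hNpos.le, inv_mul_cancel₀ hNpos.ne']
  · have hQ' : (weilQuadratic fun t ↦ (c : ℂ) * W t).re = c * c * (weilQuadratic W).re := by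
      rw [weilQuadratic_const_mul, Complex.normSq_ofReal, Complex.re_ofReal_mul]
    rw [hQ', hcc, one_div, inv_mul_eq_div, div_le_iff₀ hNpos]
    nlinarith [hlt]
  · simp only [hWdef]
    rw [hfe]

end Criterion

end Summit.RiemannHypothesis.RiemannHypothesis.Theorems.PolarPerronFrobenius

end
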